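import Literature.MathematicalPhysics.QuantumFieldTheory.Balaban1983to89.B8CubeMemberZdRec
import Literature.MathematicalPhysics.QuantumFieldTheory.Balaban1983to89.B8Prop6OfThm4Rec
import Literature.MathematicalPhysics.QuantumFieldTheory.Balaban1983to89.B8Eq131CubesAdmissibleRec
import Literature.MathematicalPhysics.QuantumFieldTheory.Balaban1983to89.B8Prop6CubeMember

/-!
# `Balaban1983to89.B8Prop6CubeMemberRec` — [Balaban1985RegularSpaces] p. 99 «the assumptions of Theorem 4 are satisfied for the pair of configurations 1, U₀″» FOR THE RECORD's
# CENTRED TOWER ([Balaban1987RG1] (0.3)–(0.4)): `|U₀″ − 1| ≤ 6dL²Mα₀` everywhere, and the Theorem-4 hypothesis package at the pair `(1, U₀″)` — unitarity, (1.33), (1.34) = (1.132)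
# with the axial class at EVERY truncation level `m ≤ k` w.r.t. `cubeLamSZ … m`, (1.66) = (1.133) in box form — the record twin of `B8Prop6CubeMember` §1–§2 (R6 (b); LEAD PEN dag-n05-e)

statement-level skeleton of published theorems with citation tags; proofs where landed; nothing here is a claim about the Yang–Mills mass gap

CITATION HEADER (lean-in-tree rule).  Cell `pub-ymgap` (HUMAN RULING D-0062), «N05-REC» road (director-ym №254∕№255; LEAD PEN dag-n05-e g37; desk `R6-PLAN.md` §2 (b); `N05-REC-INVENTORY.md` §R6
row `B8Prop6CubeMember — A: thm4_hypotheses_one_cutFixed, norm_cutFixed_sub_one_le`).  [6] = [Balaban1985RegularSpaces] (1.130)–(1.133) pp. 98–99, (1.15) p. 78, (1.19)–(1.20) p. 79,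
(1.33)–(1.34) p. 82, (1.66) p. 87, (1.68) p. 88 (`paper:balaban1985-cmp99-regular-spaces`); [I] = [Balaban1987RG1] (0.3)–(0.4) pp. 252–253.  `--kind proof --supports stmt-QuantumFields-20541`
(K0⁷; count-neutral; no definition).  RECORD INPUTS BY NAME (all landed): dag-n05-d's `B8Ineq133Rec.ineq133` ((1.133) + (1.15) on the whole centred tower), `B8Eq131CubesRec.ineq132_cubes`,
`B8Ineq132Rec.pdevOn_lt_of_inAk_box`, `B8Eq119TwistedAxialRec.{InAxZ, InAxOneZ, inAxZ_one_iff, inAxOneZ_of_tower}`, `B8Eq131CubesAdmissibleRec.{cubeFamZ, inAk_cubeFam_iff}`,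
`B8Eq131CubesRec.sq_le_tilde`, `B8Ineq130Rec.{tlo, thi, tlo_apply, thi_apply}`, `B7Prop2Rec.avgClosedZ_unitaryUnits`; the lead's `B8CubeMemberZdRec.{cubeLamSZ, inBox_sq_of_mem_cubeLamSZ}`;
class-0 `B8Prop6OfThm4.one_inAk`, `B8Lemma1NonAbelian.mulCfg`, `B8Eq131Cubes.{ctr_mem, two_crad_le, tLo_le_tHi}`.  DESIGN NOTE (R6-PLAN (a)): the engine reaches the axial class of
the truncations through the cover lemma (1.6) (`cubeLamS_cover`) because its `Ax_k(ℭ_k, 1)` is stated on `ℭ_k` only; the record's `ineq133` certifies (1.15) on the WHOLE centred tower,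
so here `Ax_m(cubeLamSZ … m, 1)` follows for every `m ≤ k` from the sub-tower below depth `k − m` (`tlo_tlo ∕ thi_thi`) — no cover lemma needed.

WHAT IS PROVED (sorry-free; odd `L = 2s + 1 ≥ 3`).  §1 `tlo_tlo`, `thi_thi` (sub-towers of the centred tower), `ends_le_sq_of_box_subset_cubeZ` (a level-`j` bond whose centred fine box lies
in `□_j` has both ends in `□_j^{(j)}`); ★ `norm_cutFixedZ_sub_one_le` — `|U₀″ − 1| ≤ 6dL²Mα₀` at EVERY bond (inside `□̃` by (1.133) at depth `k`, outside `U₀″ = 1`); §2 ★★★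
`thm4_hypotheses_one_cutFixedZ` — THE THEOREM-4 HYPOTHESES AT THE PAIR `(1, U₀″)`, RECORD TOWER: `U₀″` unitary-valued; (1.33) `1 ∈ 𝔄_k({□_j}, L³α₀)`; (1.34) `U₀″·1 ∈ 𝔄_k({□_j}, L³α₀)`
(`cubeFamZ false`) and `InAxZ L m (cubeLamSZ … m) 1 (U₀″·1)` at EVERY truncation level `m ≤ k`; (1.66) = (1.133) in the box form (every level-`j` bond whose centred box lies in `□_j`) and on
every bond (in particular the collar sides).
HONEST SCOPE.  Composition by name of landed record theorems + centred-box arithmetic; no new estimate; nothing of [6]∕[I] asserted beyond (1.130)–(1.133)'s bookkeeping; `HThm4Rec` UNDISCHARGED;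
N05 ∕ N07 NOT discharged; counts unmoved (typed 28∕28 · discharged 8∕28); one finite 𝕋⁴ programme at fixed ε — nothing continuum ∕ ℝ⁴ ∕ OS ∕ mass gap ∕ Clay.  No `def`, no `instance`, no
`notation`, no `sorry`.
-/

noncomputable section

open scoped BigOperators

namespace Literature.MathematicalPhysics.QuantumFieldTheory.Balaban1983to89.B8Prop6CubeMemberRec

open B7Prop1Explicit B7Prop1Local
open B7Prop2Explicit (pdev c2' unitaryUnits unitaryUnits_le_U1)
open B7Prop2Rec (AvgClosedZ C0Z avgClosedZ_unitaryUnits)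
open BlockAveragingZd (avgIterZ avgIterZ_zero offZ ctrShift)
open B8Lemma1NonAbelianRecLoops (halfVec)
open B8Ineq130Rec (tlo thi tlo_apply thi_apply tlo_le_thi)
open B8Ineq133Rec (cutFixedZ ineq133)
open B8Ineq132 (InAk)
open B8Ineq132Rec (pdevOn_lt_of_inAk_box)
open B8Eq119TwistedAxialRec (InAxZ InAxOneZ inAxZ_one_iff inAxOneZ_of_tower)
open B8Eq131Cubes (tLo tHi ctr ctr_mem two_crad_le tLo_le_tHi)
open B8Eq131CubesRec (sqLoZ sqHiZ cubeZ tcubeZ ineq132_cubes sq_le_tilde)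
open B8Eq131CubesAdmissibleRec (cubeFamZ inAk_cubeFam_iff cubeFam_false_of_le)
open B8Lemma1NonAbelian (mulCfg)
open B8CubeMemberZdRec (cubeLamSZ inBox_sq_of_mem_cubeLamSZ)
open B8Prop6OfThm4 (one_inAk)

export B7Prop1Explicit (Site)

variable {d : ℕ}

/-! ## §1 Sub-towers of the centred tower; bond ends; `|U₀″ − 1| ≤ 6dL²Mα₀` -/


/-- The centred tower below a cube of the tower is the tower: `tlo L (tlo L lo a) b = tlo L lo (a + b)`. [cite: Balaban1987RG1, (0.3) p.252 (nested centred blocks)] -/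
theorem tlo_tlo (L : ℕ) (lo : Site d) (a : ℕ) : ∀ b : ℕ, tlo L (tlo L lo a) b = tlo L lo (a + b)
  | 0 => rfl
  | b + 1 => by
    show (L : ℤ) • tlo L (tlo L lo a) b - halfVec L = (L : ℤ) • tlo L lo (a + b) - halfVec L
    rw [tlo_tlo L lo a b]

/-- `thi L (thi L hi a) b = thi L hi (a + b)`. [cite: Balaban1987RG1, (0.3) p.252 (nested centred blocks)] -/
theorem thi_thi (L : ℕ) (hi : Site d) (a : ℕ) : ∀ b : ℕ, thi L (thi L hi a) b = thi L hi (a + b)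
  | 0 => rfl
  | b + 1 => by
    show (L : ℤ) • thi L (thi L hi a) b + halfVec L = (L : ℤ) • thi L hi (a + b) + halfVec L
    rw [thi_thi L hi a b]

/-- **A level-`j` bond whose CENTRED fine box lies in `□_j` has both ends in `□_j^{(j)}`**: the corners `L^jz − c_j𝟙`, `L^j(z + e_μ) + c_j𝟙` of `[L^jz − c_j𝟙, L^jz + L^je_μ + c_j𝟙]` lie in
`□_j = [tlo (sqLoZ j) j, thi (sqHiZ j) j]`, whose corners are `L^j·sqLoZ − c_j𝟙`, `L^j·sqHiZ + c_j𝟙` (odd `L`). [cite: Balaban1985RegularSpaces, p.98 («□_j is a sum of the big blocks»), (1.66) p.87; Balaban1987RG1, (0.3) p.252] -/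
theorem ends_le_sq_of_box_subset_cubeZ {L : ℕ} (hLo : Odd L) (a : Site d) (M ρ k j : ℕ) {z : Site d} {μ : Fin d}
    (hbox : ∀ x, InBox (fun i => (L : ℤ) ^ j * z i - (ctrShift L j : ℤ)) (fun i => (L : ℤ) ^ j * z i + (ctrShift L j : ℤ) + if i = μ then (L : ℤ) ^ j else 0) x →
      x ∈ cubeZ L a M ρ k j) :
    sqLoZ L a ρ k j ≤ z ∧ z + e μ ≤ sqHiZ L a M ρ k j := by
  have hP : (0 : ℤ) < (L : ℤ) ^ j := by have := hLo.pos; positivity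
  have hc : (0 : ℤ) ≤ (ctrShift L j : ℤ) := by positivity
  have hlo := hbox (fun i => (L : ℤ) ^ j * z i - (ctrShift L j : ℤ)) (fun i => ⟨le_rfl, by
    simp only; split_ifs <;> nlinarith⟩)
  have hhi := hbox (fun i => (L : ℤ) ^ j * z i + (ctrShift L j : ℤ) + if i = μ then (L : ℤ) ^ j else 0) (fun i => ⟨by
    simp only; split_ifs <;> nlinarith, le_rfl⟩)
  simp only [cubeZ, Set.mem_setOf_eq] at hlo hhi
  constructor
  · intro i
    have h := (hlo i).1
    rw [tlo_apply hLo] at h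
    dsimp only at h
    have : (L : ℤ) ^ j * sqLoZ L a ρ k j i ≤ (L : ℤ) ^ j * z i := by linarith
    exact le_of_mul_le_mul_left this hP
  · intro i
    have h := (hhi i).2
    rw [thi_apply hLo] at h
    dsimp only at h
    rw [add_e_apply]
    have h' : (L : ℤ) ^ j * (z i + (if i = μ then 1 else 0)) ≤ (L : ℤ) ^ j * sqHiZ L a M ρ k j i := by
      split_ifs at h ⊢ <;> nlinarith
    exact le_of_mul_le_mul_left h' hP

section Analytic

variable {𝔸 : Type*} [NormedRing 𝔸] [NormOneClass 𝔸] [NormedAlgebra ℂ 𝔸] [CompleteSpace 𝔸]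

/-- ★ (RECORD TWIN of `B8Prop6CubeMember.norm_cutFixed_sub_one_le`.) **`|U₀″ − 1| ≤ 6dL²Mα₀` AT EVERY BOND OF `T_η`, record tower**: inside `□̃` this is (1.133) at depth `k` (`j = 0`), which
holds on the whole of `□̃` (`B8Ineq133Rec.ineq133`, last clause); outside, `U₀″ = 1`.  Setting as in `B8Eq131CubesRec.ineq132_cubes`.
[cite: Balaban1985RegularSpaces, (1.133) p.99, p.99 («equal to U₀′ on □̃, and equal to 1 outside □̃»), (1.130) p.98; Balaban1987RG1, (0.4) p.253] -/
theorem norm_cutFixedZ_sub_one_le {L s : ℕ} (hLs : L = 2 * s + 1) (hL : 2 ≤ L) (hd : 1 ≤ d) {G : Subgroup 𝔸ˣ} (hG : AvgClosedZ d L G) (k : ℕ)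
    (U : Site d → Fin d → 𝔸ˣ) (hU : ∀ x κ, U x κ ∈ G) {α₀ : ℝ} (hα : 0 < α₀)
    (hα3 : C0Z d * (α₀ * (L : ℝ) ^ 2) ≤ 1 / 3) (hα2 : 2 * (α₀ * (L : ℝ) ^ 2) ≤ c2' d L)
    (a : Site d) {M ρ : ℕ} (hρ : 1 ≤ ρ) (hρM : ρ ≤ M) (hM : 11 * (d : ℝ) < M)
    {η : ℝ} {Ω : ℕ → Set (Site d)} (hA : InAk L k η α₀ Ω U) (hT : tcubeZ L a M ρ k ⊆ Ω (k - 1))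
    (hsmall : 11 * (d : ℝ) ^ 2 * (L : ℝ) ^ 2 * α₀ + ((M : ℝ) + 4 * ρ) * d * (L : ℝ) ^ 2 * α₀ ≤ 1 / 6) (x : Site d) (ν : Fin d) :
    ‖((cutFixedZ L (tLo a ρ) (tHi a M ρ) U k (ctr a M) x ν : 𝔸ˣ) : 𝔸) - 1‖ ≤ 6 * d * (L : ℝ) ^ 2 * M * α₀ := by
  have hL1 : 1 ≤ L := le_trans (by norm_num) hL
  have hM1 : 1 ≤ M := hρ.trans hρM
  obtain ⟨hy, hy', hrad⟩ := ctr_mem (a := a) (ρ := ρ) hM1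
  have hRM : (ρ : ℝ) * 1 ≤ (M : ℝ) := by rw [mul_one]; exact_mod_cast hρM
  have hsmall' : 11 * (d : ℝ) ^ 2 * (L : ℝ) ^ 2 * α₀ + ((M : ℝ) + 4 * ρ * 1) * d * (L : ℝ) ^ 2 * α₀ ≤ 1 / 6 := by rwa [mul_one]
  have hΩ : ∃ l, l ≤ k ∧ k ≤ l + 1 ∧ ∀ x, InBox (tlo L (tLo a ρ) k) (thi L (tHi a M ρ) k) x → x ∈ Ω l :=
    ⟨k - 1, Nat.sub_le _ _, by omega, fun x hx => hT hx⟩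
  have h17 := pdevOn_lt_of_inAk_box hL1 hα hA hΩ
  obtain ⟨-, hone, -, -, -, h6⟩ := ineq133 hLs hL hd hG k U hU hα hα3 hα2 (tLo a ρ) (tHi a M ρ) (tLo_le_tHi hM1) h17 hy hy' hrad (two_crad_le M ρ) hRM hM hsmall'
  have hbd0 : 0 ≤ 6 * d * (L : ℝ) ^ 2 * M * α₀ := by positivity
  by_cases hin : InBox (tlo L (tLo a ρ) k) (thi L (tHi a M ρ) k) x ∧ InBox (tlo L (tLo a ρ) k) (thi L (tHi a M ρ) k) (x + e ν)
  · have h := h6 k le_rfl x ν (fun i => (hin.1 i).1) (fun i => (hin.2 i).2)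
    rw [Nat.sub_self, avgIterZ_zero] at h
    exact h.le
  · rw [hone x ν hin, Units.val_one, sub_self, norm_zero]
    exact hbd0

end Analytic

/-! ## §2 The Theorem-4 hypotheses at the pair `(1, U₀″)`, record tower -/

section Hypotheses

variable {𝔸 : Type*} [CStarAlgebra 𝔸] [Nontrivial 𝔸]

/-- ★★★ (RECORD TWIN of `B8Prop6CubeMember.thm4_hypotheses_one_cutFixed`.) **«the assumptions of Theorem 4 are satisfied for the pair 1, U₀″», RECORD TOWER**: for `U₀` unitary-valued in
`𝔄_k({Ω_j}, α₀)` with «□̃ ⊂ Ω_{k−1}» (centred blow-up), odd `L = 2s + 1 ≥ 3`, `d ≥ 1`, `1 ≤ ρ ≤ M`, `11d < M`, the record's Prop-1∕2 smallness and that of (1.130): `U₀″ = cutFixedZ …` is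
unitary-valued; (1.33) `1 ∈ 𝔄_k({□_j}, L³α₀)`; (1.34): `U₀″·1 ∈ 𝔄_k({□_j}, L³α₀)` (`cubeFamZ false`) and `InAxZ L m (cubeLamSZ … m) 1 (U₀″·1)` for EVERY truncation level `m ≤ k` ((1.15) on
the whole centred tower, read on the sub-tower below depth `k − m`); (1.66) = (1.133) in box form at every level-`j` bond whose centred box lies in `□_j`; and `|U₀″ − 1| ≤ 6dL²Mα₀` on every
bond (in particular the sides touching `□₀`). [cite: Balaban1985RegularSpaces, p.99 (sentence after (1.133)), (1.132)–(1.133) p.99, (1.33)–(1.34) p.82, (1.66) p.87, (1.15) p.78, (1.68) p.88; Balaban1987RG1, (0.3)–(0.4) pp.252–253] -/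
theorem thm4_hypotheses_one_cutFixedZ {L s : ℕ} (hLs : L = 2 * s + 1) (hL : 2 ≤ L) (hd : 1 ≤ d) (k : ℕ)
    (U : Site d → Fin d → 𝔸ˣ) (hU : ∀ x κ, U x κ ∈ unitaryUnits 𝔸) {α₀ : ℝ} (hα : 0 < α₀)
    (hα3 : C0Z d * (α₀ * (L : ℝ) ^ 2) ≤ 1 / 3) (hα2 : 2 * (α₀ * (L : ℝ) ^ 2) ≤ c2' d L)
    (a : Site d) {M ρ : ℕ} (hρ : 1 ≤ ρ) (hρM : ρ ≤ M) (hM : 11 * (d : ℝ) < M)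
    {η : ℝ} (hη : 0 < η) {Ω : ℕ → Set (Site d)} (hA : InAk L k η α₀ Ω U) (hT : tcubeZ L a M ρ k ⊆ Ω (k - 1))
    (hsmall : 11 * (d : ℝ) ^ 2 * (L : ℝ) ^ 2 * α₀ + ((M : ℝ) + 4 * ρ) * d * (L : ℝ) ^ 2 * α₀ ≤ 1 / 6) :
    (∀ x κ, cutFixedZ L (tLo a ρ) (tHi a M ρ) U k (ctr a M) x κ ∈ unitaryUnits 𝔸) ∧
    InAk L k η ((L : ℝ) ^ 3 * α₀) (cubeFamZ false L a M ρ k) (1 : Site d → Fin d → 𝔸ˣ) ∧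
    InAk L k η ((L : ℝ) ^ 3 * α₀) (cubeFamZ false L a M ρ k) (mulCfg (cutFixedZ L (tLo a ρ) (tHi a M ρ) U k (ctr a M)) (1 : Site d → Fin d → 𝔸ˣ)) ∧
    (∀ m, m ≤ k → InAxZ L m (cubeLamSZ L a M ρ k m) (1 : Site d → Fin d → 𝔸ˣ) (mulCfg (cutFixedZ L (tLo a ρ) (tHi a M ρ) U k (ctr a M)) (1 : Site d → Fin d → 𝔸ˣ))) ∧
    (∀ j, j ≤ k → ∀ (z : Site d) (μ : Fin d),
      (∀ x, InBox (fun i => (L : ℤ) ^ j * z i - (ctrShift L j : ℤ)) (fun i => (L : ℤ) ^ j * z i + (ctrShift L j : ℤ) + if i = μ then (L : ℤ) ^ j else 0) x →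
        x ∈ cubeFamZ false L a M ρ k j) →
        ‖(avgIterZ L (mulCfg (cutFixedZ L (tLo a ρ) (tHi a M ρ) U k (ctr a M)) (1 : Site d → Fin d → 𝔸ˣ)) j z μ : 𝔸) - (avgIterZ L (1 : Site d → Fin d → 𝔸ˣ) j z μ : 𝔸)‖
          ≤ 6 * d * (L : ℝ) ^ 2 * M * α₀) ∧
    (∀ (x : Site d) (ν : Fin d), ‖((cutFixedZ L (tLo a ρ) (tHi a M ρ) U k (ctr a M) x ν : 𝔸ˣ) : 𝔸) - 1‖ ≤ 6 * d * (L : ℝ) ^ 2 * M * α₀) := by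
  have hLo : Odd L := ⟨s, hLs⟩
  have hL1 : 1 ≤ L := le_trans (by norm_num) hL
  have hM1 : 1 ≤ M := hρ.trans hρM
  have hG := avgClosedZ_unitaryUnits (𝔸 := 𝔸) d L
  have hLpos : (0 : ℝ) < L := by exact_mod_cast lt_of_lt_of_le (by norm_num) hL
  have hα₀' : 0 < (L : ℝ) ^ 3 * α₀ := by positivity
  set W := cutFixedZ L (tLo a ρ) (tHi a M ρ) U k (ctr a M) with hW
  have hW1 : mulCfg W (1 : Site d → Fin d → 𝔸ˣ) = W := by funext x μ; simp [mulCfg]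
  obtain ⟨h132a, h132b, h133⟩ := ineq132_cubes hLs hL hd hG k U hU hα hα3 hα2 a hρ hρM hM hη hA hT hsmall
  -- the full (1.15) on the centred tower and unitarity, from `ineq133`
  obtain ⟨hy, hy', hrad⟩ := ctr_mem (a := a) (ρ := ρ) hM1
  have hRM : (ρ : ℝ) * 1 ≤ (M : ℝ) := by rw [mul_one]; exact_mod_cast hρM
  have hsmall' : 11 * (d : ℝ) ^ 2 * (L : ℝ) ^ 2 * α₀ + ((M : ℝ) + 4 * ρ * 1) * d * (L : ℝ) ^ 2 * α₀ ≤ 1 / 6 := by rwa [mul_one]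
  have hΩ : ∃ l, l ≤ k ∧ k ≤ l + 1 ∧ ∀ x, InBox (tlo L (tLo a ρ) k) (thi L (tHi a M ρ) k) x → x ∈ Ω l :=
    ⟨k - 1, Nat.sub_le _ _, by omega, fun x hx => hT hx⟩
  have h17 := pdevOn_lt_of_inAk_box hL1 hα hA hΩ
  obtain ⟨hmem, -, -, h15, -, -⟩ := ineq133 hLs hL hd hG k U hU hα hα3 hα2 (tLo a ρ) (tHi a M ρ) (tLo_le_tHi hM1) h17 hy hy' hrad (two_crad_le M ρ) hRM hM hsmall'
  refine ⟨hmem, one_inAk hL1 k hη hα₀' _, ?_, ?_, ?_, ?_⟩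
  · -- (1.34), 𝔄-part
    rw [hW1, inAk_cubeFam_iff]; exact h132a
  · -- (1.34), axial part at every truncation level: (1.15) on the sub-tower below depth `k − m`
    intro m hm
    rw [hW1, inAxZ_one_iff]
    refine inAxOneZ_of_tower hLo (lo := tlo L (tLo a ρ) (k - m)) (hi := thi L (tHi a M ρ) (k - m)) (fun n hn z hz hz' r => ?_) (fun j hj1 hjm x hx => ?_)
    · rw [tlo_tlo] at hz
      rw [thi_thi] at hz'
      have h := h15 (k - m + n) (by omega) z hz hz' r
      rwa [show k - (k - m + n + 1) = m - (n + 1) by omega] at h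
    · have hsq := inBox_sq_of_mem_cubeLamSZ hx
      obtain ⟨h1, h2⟩ := sq_le_tilde hLo hL a M ρ k j
      rw [tlo_tlo, thi_thi, show k - m + (m - j) = k - j by omega]
      exact ⟨fun i => (h1 i).trans (hsq i).1, fun i => (hsq i).2.trans (h2 i)⟩
  · -- (1.66) = (1.133) in the box form
    intro j hj z μ hbox
    rw [hW1, BlockAveragingZd.avgIterZ_one, Pi.one_apply, Pi.one_apply, Units.val_one]
    have hbox' : ∀ x, InBox (fun i => (L : ℤ) ^ j * z i - (ctrShift L j : ℤ)) (fun i => (L : ℤ) ^ j * z i + (ctrShift L j : ℤ) + if i = μ then (L : ℤ) ^ j else 0) x →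
        x ∈ cubeZ L a M ρ k j := fun x hx => by
      have h := hbox x hx
      rwa [cubeFam_false_of_le L a M ρ hj] at h
    obtain ⟨hlo, hhi⟩ := ends_le_sq_of_box_subset_cubeZ hLo a M ρ k j hbox'
    exact (h133 j hj z μ hlo hhi).le
  · exact fun x ν => norm_cutFixedZ_sub_one_le hLs hL hd hG k U hU hα hα3 hα2 a hρ hρM hM hA hT hsmall x ν

end Hypotheses

end Literature.MathematicalPhysics.QuantumFieldTheory.Balaban1983to89.B8Prop6CubeMemberRec
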